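import Literature.MathematicalPhysics.QuantumFieldTheory.Balaban1983to89.B4Eq19LatticeGradientCampanato
import Literature.MathematicalPhysics.QuantumFieldTheory.Balaban1983to89.B4Eq19CampanatoIterationSharp
import HarnessLib

/-!
# Line «poincare_lipschitz» on crux `HistoryTailL` (stmt-QuantumFields-19936), route crux `BlockLipschitzL` (stmt-QuantumFields-23533), K2 deep regime —
# «RIESZ-LOG-FLAT»: THE `ℓ^∞ → BMO → ℓ^∞ (log)` BOUND FOR THE LATTICE RIESZ TRANSFORM `∇Δ⁻¹∂*` ON `ℤ^d` — if `−Δu = ∂*g` with `|g| ≤ m` on `Q_{N+2}(x)`,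
# then `∂_μu` has bounded mean oscillation at every scale `ρ ≤ N` around `x` (`exc (∂_μu)(Q_ρ(x)) ≤ C_d[((ρ+1)∕(N+1))^d·exc (∂_μu)(Q_N(x)) + m²(ρ+1)^d]`)
# and `|∂_μu(x) − avg_{Q_N(x)}∂_μu| ≤ C_d·(1 + log₂(N+1))·(m + ((N+1)^{−d}·Σ_{Q_N(x)}|∇u|²)^{1∕2})` — the flat linear shadow of the per-bond chart of the
# box-ℓ² Coulomb projection («M-COUL»: `φ = Δ⁻¹d*A`, `|∇φ| ≲ ‖A‖_∞·log R`)

Cell `ym3-torus` (YM ladder rung R3 = continuum SU(2) Yang–Mills on the three-torus — a RUNG, NOT the Clay problem: not d = 4, not infinite volume, not a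
mass gap); width seat `ym-ust-19936-w5` gen 11 (bus 2026-08-29T02:5xZ CLAIM «RIESZ-LOG-FLAT»; w2 g11 (F6 pen) 02:39:35Z «(M1) GO: flat linear shadow of M-COUL
= ‖DΔ⁻¹D*‖_{∞→∞} ≲ log R»; ★w3 g12 LOCATE PHI-MV #40; my LOCATE K2-DEEP-QUADRATIC).  THEOREMS ONLY (def-free), in the `ℤ^d` letters of ✓`B4Eq19LatticeOperators`∕
✓`B4Eq19LatticeBoxMeans` (`lop`, `dvg`, `fdiff`, `gradSq`, `box`, `boxAvg`, `exc`); `--supports stmt-QuantumFields-19936`.  Nothing here proves the per-bond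
charts of F6-ROW-CHART, `hStab`, F6, a stub, `BlockLipschitzL`, `HistoryTailL` or a summit statement.

WHY.  F6 (w2 g11 ✓p689173∕⧗p690145∕F6-ROW-CHART) reduces `stub_iteratedLipschitz` to PER-BOND CHARTS of the re-gauged tower AT THE BOX-ℓ² ORBIT MINIMISER;
ALIGN (★w3 g12) gives the chart in ITS gauge, and the transfer to the minimiser's gauge costs `‖∇_Vφ‖_∞` for the relative gauge `φ` — in the abelian linear model
`φ = Δ⁻¹d*A` (Neumann Coulomb projection), `∇φ = ∇Δ⁻¹∂*A`, a lattice RIESZ TRANSFORM of the bounded 1-form `A`: `ℓ^∞`-bounded only up to a logarithm of the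
number of scales.  The flat road in the tree has the gradient Campanato theory with HÖLDER data (✓`B4Eq19LatticeGradientCampanato`, exponent `d+1`) and with bounded
NON-divergence data (✓`Prop7FlatInteriorGradient`), and the SUP bound for the corrector (✓`Prop7FlatDirichletSup`, linear in the radius); the bounded
DIVERGENCE-FORM data case — exponent `d`, i.e. BMO, and the logarithmic sup bound — is this file.  Proof = the tree's road with one exponent changed:
massless harmonic replacement (✓`exists_harmonic_replacement_zero`) whose corrector has energy `≤ Σ|g|² ≤ d·5^d·m²·(r+1)^d`, gradient excess decay of the
harmonic part (✓`gradient_excess_decay`, exponent `d+2`), Campanato's iteration with `q = d` (✓`campanato_iteration_sharp`), and a dyadic telescope of box means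
(✓`card_mul_sq_sub_le_exc`) for the logarithm.

* §1 ★ `gradient_campanato_step_dvg` — `−Δu = ∂*g`, `|g| ≤ m` on `Q_{r+2}(x)`, `0 ≤ ρ ≤ r` ⇒
  `exc (∂_μu)(Q_ρ(x)) ≤ 4A₁((ρ+1)∕(r+1))^{d+2}·exc (∂_μu)(Q_r(x)) + (4A₁+2)·d·5^d·m²·(r+1)^d` (`A₁` of ✓`gradient_excess_decay`).
* §2 `exc_campanato_hypothesis_d` (the real-variable form, data exponent `d`), ★★ `exc_fdiff_le_of_dvg` — BMO AT EVERY SCALE: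
  `exc (∂_μu)(Q_ρ(x)) ≤ (4A)^d((ρ+1)∕(N+1))^d·exc (∂_μu)(Q_N(x)) + (4∕3)(4A)^{2d}·(4A₁+2)d5^d·m²·(ρ+1)^d` for `0 ≤ ρ ≤ N` (`A = 4·2^{d+1}A₁`).
* §3 `boxAvg_zero_radius`, `abs_boxAvg_sub_boxAvg_le` (one dyadic step costs `√(2^d)·M`), `abs_sub_boxAvg_dyadic_le`, ★★ `abs_sub_boxAvg_le_log` (BMO ⇒ `ℓ^∞` up to
  `log₂(N+1) + 1` steps, any `f`), ★★★ `abs_fdiff_sub_boxAvg_le_log_of_dvg` — the title.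
[folklore] ([Giaquinta1984] Ch. III §2–3 (Campanato spaces, `𝓛^{2,d} = BMO`); Fefferman–Stein∕John–Nirenberg for the logarithm; [Balaban1984PropagatorsII] (1.9) p.226
the print locus of the flat lattice estimates).
-/

set_option autoImplicit false

noncomputable section

open scoped BigOperators
open Finset

namespace Summit.QuantumFields.YangMills.Theorems.PoincareLipschitzFlatRieszLog

open Literature.MathematicalPhysics.QuantumFieldTheory.Balaban1983to89
open B4Eq19LatticeOperators B4Eq19LatticeBoxMeans B4Eq19LatticeDirichletReplacement B4Eq19LatticeDirichletZero
open B4Eq19LatticeGradientExcessDecay (gradient_excess_decay)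
open B4Eq19LatticeGradientCampanato (sum_sq_fdiff_le_gradSq)
open B4Eq19CampanatoIterationSharp (campanato_iteration_sharp)

variable {d : ℕ}

/-! ## §1 The Campanato step with bounded divergence-form data -/

/-- ★ **THE GRADIENT CAMPANATO STEP WITH BOUNDED DIVERGENCE-FORM DATA**: if `−Δu = ∂*g` on `Q_{r+2}(x)` (`lop 0 u = dvg g`) and `|g(y,ν)| ≤ m` there, then for
`0 ≤ ρ ≤ r` and every `μ`:
`exc (∂_μu)(Q_ρ(x)) ≤ 4A₁·((ρ+1)∕(r+1))^{d+2}·exc (∂_μu)(Q_r(x)) + (4A₁+2)·d·5^d·m²·(r+1)^d`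
(massless harmonic replacement on `Q_{r+1}(x)`; the corrector's energy is `≤ Σ_{Q_{r+2}}|g|² ≤ d·(2r+5)^d·m²`). [folklore]
[cite: Giaquinta1984, Ch. III §2 (2.5)-(2.8) pp.78-79; Balaban1984PropagatorsII, (1.9) p.226] -/
theorem gradient_campanato_step_dvg (hd : 1 ≤ d) (u : Zd d → ℝ) (g : Zd d → Fin d → ℝ) (x : Zd d) {m : ℝ} {ρ r : ℤ} (hρ : 0 ≤ ρ)
    (hρr : ρ ≤ r) (hEq : ∀ y ∈ box x (r + 2), lop 0 u y = dvg g y) (hg : ∀ y ∈ box x (r + 2), ∀ ν, |g y ν| ≤ m) (μ : Fin d) :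
    exc (fdiff μ u) x ρ ≤
      4 * ((4 : ℝ) ^ d * d ^ 2 * (1 + 56 * d) ^ d * ((2 : ℝ) ^ d * (1 + 56 * d) ^ d * (8 * ((d : ℝ) + 1)) ^ (d + 1)) *
          (896 * d * (12 * (d : ℝ) + 8) ^ d) + (12 * (d : ℝ) + 8) ^ (d + 2)) * (((ρ : ℝ) + 1) / ((r : ℝ) + 1)) ^ (d + 2) * exc (fdiff μ u) x r +
      (4 * ((4 : ℝ) ^ d * d ^ 2 * (1 + 56 * d) ^ d * ((2 : ℝ) ^ d * (1 + 56 * d) ^ d * (8 * ((d : ℝ) + 1)) ^ (d + 1)) *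
          (896 * d * (12 * (d : ℝ) + 8) ^ d) + (12 * (d : ℝ) + 8) ^ (d + 2)) + 2) * ((d : ℝ) * 5 ^ d * m ^ 2 * ((r : ℝ) + 1) ^ d) := by
  set A₁ : ℝ := (4 : ℝ) ^ d * d ^ 2 * (1 + 56 * d) ^ d * ((2 : ℝ) ^ d * (1 + 56 * d) ^ d * (8 * ((d : ℝ) + 1)) ^ (d + 1)) *
          (896 * d * (12 * (d : ℝ) + 8) ^ d) + (12 * (d : ℝ) + 8) ^ (d + 2) with hA₁
  have hd0 : 0 < d := by omega
  have hdR : (0 : ℝ) ≤ d := Nat.cast_nonneg d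
  have hA₁0 : 0 ≤ A₁ := by positivity
  have hr0 : 0 ≤ r := hρ.trans hρr
  have hr0R : (0 : ℝ) ≤ r := by exact_mod_cast hr0
  have hρR : (0 : ℝ) ≤ ρ := by exact_mod_cast hρ
  have hρrR : (ρ : ℝ) ≤ r := by exact_mod_cast hρr
  have hr1 : (0 : ℝ) < (r : ℝ) + 1 := by linarith
  -- the energy of the data on `Q_{r+2}(x)`
  set W : ℝ := (d : ℝ) * 5 ^ d * m ^ 2 * ((r : ℝ) + 1) ^ d with hW
  have hW0 : 0 ≤ W := by positivity
  have hdata : ∑ y ∈ box x (r + 2), ∑ ν, g y ν ^ 2 ≤ W := by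
    have hcard : ((box x (r + 2)).card : ℝ) = ((2 * (r + 2) + 1 : ℤ) : ℝ) ^ d := card_box x (by linarith)
    have hpt : ∀ y ∈ box x (r + 2), ∑ ν, g y ν ^ 2 ≤ d * m ^ 2 := by
      intro y hy
      calc ∑ ν, g y ν ^ 2 ≤ ∑ _ν : Fin d, m ^ 2 := Finset.sum_le_sum fun ν _ => by
              rw [← sq_abs]; exact pow_le_pow_left₀ (abs_nonneg _) (hg y hy ν) 2
        _ = d * m ^ 2 := by rw [Finset.sum_const, Finset.card_univ, Fintype.card_fin, nsmul_eq_mul]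
    have e2 : ((2 * (r + 2) + 1 : ℤ) : ℝ) ^ d ≤ 5 ^ d * ((r : ℝ) + 1) ^ d := by
      rw [← mul_pow]; apply pow_le_pow_left₀ (by push_cast; linarith); push_cast; linarith
    calc ∑ y ∈ box x (r + 2), ∑ ν, g y ν ^ 2 ≤ ∑ y ∈ box x (r + 2), (d : ℝ) * m ^ 2 := Finset.sum_le_sum hpt
      _ = ((2 * (r + 2) + 1 : ℤ) : ℝ) ^ d * (d * m ^ 2) := by rw [Finset.sum_const, nsmul_eq_mul, hcard]
      _ ≤ (5 ^ d * ((r : ℝ) + 1) ^ d) * (d * m ^ 2) := mul_le_mul_of_nonneg_right e2 (by positivity)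
      _ = W := by rw [hW]; ring
  -- massless harmonic replacement on `Q_{r+1}(x)`
  obtain ⟨h, w, huhw, hw0, hh, hwE⟩ := exists_harmonic_replacement_zero hd0 u g x (r + 1) (fun y hy => hEq y (box_mono x (by linarith) hy))
  have hwE' : ∀ Q : Finset (Zd d), gradSq w Q ≤ W := fun Q =>
    (hwE Q).trans (le_of_eq_of_le (by rw [show r + 1 + 1 = r + 2 by ring]) hdata)
  -- excess of `∂_μ u` vs `∂_μ h`
  have hfd : ∀ y, fdiff μ u y = fdiff μ h y + fdiff μ w y := fun y => by
    simp only [fdiff_apply, huhw]; ring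
  have hfd' : ∀ y, fdiff μ h y = fdiff μ u y + (-(fdiff μ w y)) := fun y => by rw [hfd y]; ring
  have hexcw : ∀ s : ℤ, exc (fdiff μ w) x s ≤ W := fun s =>
    (exc_le_sum_sq _ x s).trans ((sum_sq_fdiff_le_gradSq w _ μ).trans (hwE' _))
  have hexcw' : ∀ s : ℤ, exc (fun y => -(fdiff μ w y)) x s ≤ W := fun s =>
    (exc_le_sum_sq _ x s).trans (le_trans (by simp only [neg_sq]; exact le_rfl) ((sum_sq_fdiff_le_gradSq w _ μ).trans (hwE' _)))
  have hq0 : 0 ≤ ((ρ : ℝ) + 1) / ((r : ℝ) + 1) := by positivity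
  have hq1' : ((ρ : ℝ) + 1) / ((r : ℝ) + 1) ≤ 1 := by rw [div_le_one hr1]; linarith
  have hq1 : (((ρ : ℝ) + 1) / ((r : ℝ) + 1)) ^ (d + 2) ≤ 1 := pow_le_one₀ hq0 hq1'
  have hdec := gradient_excess_decay hρ hρr h hh μ
  rw [← hA₁] at hdec
  have e_u : exc (fdiff μ u) x ρ = exc (fun y => fdiff μ h y + fdiff μ w y) x ρ := by
    congr 1; funext y; exact hfd y
  have e_h : exc (fdiff μ h) x r = exc (fun y => fdiff μ u y + (-(fdiff μ w y))) x r := by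
    congr 1; funext y; exact hfd' y
  have hexc_h_r : exc (fdiff μ h) x r ≤ 2 * exc (fdiff μ u) x r + 2 * W := by
    rw [e_h]; exact (exc_add_le _ _ x r).trans (by linarith [hexcw' r])
  have hexc_u_ρ : exc (fdiff μ u) x ρ ≤ 2 * exc (fdiff μ h) x ρ + 2 * W := by
    rw [e_u]; exact (exc_add_le _ _ x ρ).trans (by linarith [hexcw ρ])
  have hexcur : 0 ≤ exc (fdiff μ u) x r := exc_nonneg _ _ _
  calc exc (fdiff μ u) x ρ ≤ 2 * exc (fdiff μ h) x ρ + 2 * W := hexc_u_ρ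
    _ ≤ 2 * (A₁ * (((ρ : ℝ) + 1) / ((r : ℝ) + 1)) ^ (d + 2) * exc (fdiff μ h) x r) + 2 * W := by linarith [hdec]
    _ ≤ 2 * (A₁ * (((ρ : ℝ) + 1) / ((r : ℝ) + 1)) ^ (d + 2) * (2 * exc (fdiff μ u) x r + 2 * W)) + 2 * W := by
        have := mul_le_mul_of_nonneg_left hexc_h_r (by positivity : (0 : ℝ) ≤ A₁ * (((ρ : ℝ) + 1) / ((r : ℝ) + 1)) ^ (d + 2))
        linarith
    _ = 4 * A₁ * (((ρ : ℝ) + 1) / ((r : ℝ) + 1)) ^ (d + 2) * exc (fdiff μ u) x r +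
          (4 * A₁ * (((ρ : ℝ) + 1) / ((r : ℝ) + 1)) ^ (d + 2) + 2) * W := by ring
    _ ≤ 4 * A₁ * (((ρ : ℝ) + 1) / ((r : ℝ) + 1)) ^ (d + 2) * exc (fdiff μ u) x r + (4 * A₁ + 2) * W := by
        have : 4 * A₁ * (((ρ : ℝ) + 1) / ((r : ℝ) + 1)) ^ (d + 2) ≤ 4 * A₁ := by
          have := mul_le_mul_of_nonneg_left hq1 (by positivity : (0:ℝ) ≤ 4 * A₁); linarith
        have := mul_le_mul_of_nonneg_right (add_le_add_right this 2) hW0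
        linarith

/-! ## §2 BMO: Campanato's iteration with `q = d` -/

/-- **The real-variable hypothesis, data exponent `d`**: from the integer-radius step `exc_ρ ≤ 4A₁((ρ+1)∕(r+1))^{d+2} exc_r + B(r+1)^d` (`0 ≤ ρ ≤ r ≤ N`) to
`ψ(P) ≤ (4·2^{d+1}A₁)(P∕R)^{d+1}ψ(R) + B R^d` for `ψ(t) = exc_{⌊t⌋−1}`, `1 ≤ P ≤ R ≤ N+1` (`(⌊P⌋∕⌊R⌋)^{d+2} ≤ (⌊P⌋∕⌊R⌋)^{d+1} ≤ 2^{d+1}(P∕R)^{d+1}`,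
`⌊R⌋ ≤ R`). [folklore] [cite: Giaquinta1984, Ch. III Lemma 2.1 p.86] -/
theorem exc_campanato_hypothesis_d (f : Zd d → ℝ) (x : Zd d) {N : ℤ} {A₁ B : ℝ} (hA₁ : 0 ≤ A₁) (hB : 0 ≤ B)
    (hstep : ∀ ρ r : ℤ, 0 ≤ ρ → ρ ≤ r → r ≤ N →
      exc f x ρ ≤ 4 * A₁ * (((ρ : ℝ) + 1) / ((r : ℝ) + 1)) ^ (d + 2) * exc f x r + B * ((r : ℝ) + 1) ^ d) :
    ∀ P R : ℝ, 1 ≤ P → P ≤ R → R ≤ (N : ℝ) + 1 →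
      exc f x (⌊P⌋ - 1) ≤ (4 * 2 ^ (d + 1) * A₁) * (P / R) ^ (d + 1) * exc f x (⌊R⌋ - 1) + B * R ^ d := by
  intro P R hP hPR hR
  have hfP : (1 : ℤ) ≤ ⌊P⌋ := by have := Int.floor_le_floor hP; rwa [Int.floor_one] at this
  have hfPR : ⌊P⌋ ≤ ⌊R⌋ := Int.floor_le_floor hPR
  have hfR : ⌊R⌋ ≤ N + 1 := by
    have := Int.floor_le_floor hR
    rwa [show ((N : ℝ) + 1) = ((N + 1 : ℤ) : ℝ) by push_cast; ring, Int.floor_intCast] at this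
  have h := hstep (⌊P⌋ - 1) (⌊R⌋ - 1) (by linarith) (by linarith) (by linarith)
  have e1 : (((⌊P⌋ - 1 : ℤ) : ℝ) + 1) = (⌊P⌋ : ℝ) := by push_cast; ring
  have e2 : (((⌊R⌋ - 1 : ℤ) : ℝ) + 1) = (⌊R⌋ : ℝ) := by push_cast; ring
  rw [e1, e2] at h
  have hfP1 : (1 : ℝ) ≤ (⌊P⌋ : ℝ) := by exact_mod_cast hfP
  have hfR1 : (1 : ℝ) ≤ (⌊R⌋ : ℝ) := by have : (1:ℤ) ≤ ⌊R⌋ := hfP.trans hfPR; exact_mod_cast this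
  have hfRpos : (0 : ℝ) < (⌊R⌋ : ℝ) := by linarith
  have hR0 : 0 < R := by linarith
  have hratio : (⌊P⌋ : ℝ) / (⌊R⌋ : ℝ) ≤ 2 * (P / R) := by
    rw [div_le_iff₀ hfRpos]
    have h2 : R < (⌊R⌋ : ℝ) + 1 := Int.lt_floor_add_one R
    calc (⌊P⌋ : ℝ) ≤ P := Int.floor_le P
      _ = (P / R) * R := by field_simp
      _ ≤ (P / R) * (2 * (⌊R⌋ : ℝ)) := mul_le_mul_of_nonneg_left (by linarith) (by positivity)
      _ = 2 * (P / R) * (⌊R⌋ : ℝ) := by ring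
  have hratio0 : 0 ≤ (⌊P⌋ : ℝ) / (⌊R⌋ : ℝ) := by positivity
  have hratio1 : (⌊P⌋ : ℝ) / (⌊R⌋ : ℝ) ≤ 1 := by
    rw [div_le_one hfRpos]; exact_mod_cast hfPR
  have hratio_d : ((⌊P⌋ : ℝ) / (⌊R⌋ : ℝ)) ^ (d + 2) ≤ 2 ^ (d + 1) * (P / R) ^ (d + 1) := by
    calc ((⌊P⌋ : ℝ) / (⌊R⌋ : ℝ)) ^ (d + 2) ≤ ((⌊P⌋ : ℝ) / (⌊R⌋ : ℝ)) ^ (d + 1) := pow_le_pow_of_le_one hratio0 hratio1 (by omega)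
      _ ≤ (2 * (P / R)) ^ (d + 1) := pow_le_pow_left₀ hratio0 hratio (d + 1)
      _ = 2 ^ (d + 1) * (P / R) ^ (d + 1) := by rw [mul_pow]
  have hRd : (⌊R⌋ : ℝ) ^ d ≤ R ^ d := pow_le_pow_left₀ hfRpos.le (Int.floor_le R) d
  have hψR0 : 0 ≤ exc f x (⌊R⌋ - 1) := exc_nonneg _ _ _
  calc exc f x (⌊P⌋ - 1) ≤ 4 * A₁ * ((⌊P⌋ : ℝ) / (⌊R⌋ : ℝ)) ^ (d + 2) * exc f x (⌊R⌋ - 1) + B * (⌊R⌋ : ℝ) ^ d := h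
    _ ≤ 4 * A₁ * (2 ^ (d + 1) * (P / R) ^ (d + 1)) * exc f x (⌊R⌋ - 1) + B * R ^ d := by
        have t1 := mul_le_mul_of_nonneg_left hratio_d (by positivity : (0:ℝ) ≤ 4 * A₁)
        have t2 := mul_le_mul_of_nonneg_right t1 hψR0
        have t3 := mul_le_mul_of_nonneg_left hRd hB
        exact add_le_add t2 t3
    _ = (4 * 2 ^ (d + 1) * A₁) * (P / R) ^ (d + 1) * exc f x (⌊R⌋ - 1) + B * R ^ d := by ring

/-- ★★ **BMO AT EVERY SCALE FOR THE LATTICE RIESZ TRANSFORM**: `d ≥ 1`, `N ≥ 0`; if `−Δu = ∂*g` on `Q_{N+2}(x)` and `|g| ≤ m` there, then for every `μ` and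
`0 ≤ ρ ≤ N`: `exc (∂_μu)(Q_ρ(x)) ≤ (4A)^d·((ρ+1)∕(N+1))^d·exc (∂_μu)(Q_N(x)) + (4∕3)(4A)^{2d}·(4A₁+2)·d·5^d·m²·(ρ+1)^d`, `A = 4·2^{d+1}A₁` — the mean
oscillation of `∇u` over `Q_ρ(x)` is `O(m)` PER SITE at every scale, up to the top-scale term. [folklore] [cite: Giaquinta1984, Ch. III §3 Thm 3.1 p.84] -/
theorem exc_fdiff_le_of_dvg (hd : 1 ≤ d) (u : Zd d → ℝ) (g : Zd d → Fin d → ℝ) (x : Zd d) {m : ℝ} {N : ℤ}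
    (hEq : ∀ y ∈ box x (N + 2), lop 0 u y = dvg g y) (hg : ∀ y ∈ box x (N + 2), ∀ ν, |g y ν| ≤ m) (μ : Fin d) {ρ : ℤ} (hρ : 0 ≤ ρ)
    (hρN : ρ ≤ N) :
    exc (fdiff μ u) x ρ ≤
      (4 * (4 * 2 ^ (d + 1) * ((4 : ℝ) ^ d * d ^ 2 * (1 + 56 * d) ^ d * ((2 : ℝ) ^ d * (1 + 56 * d) ^ d * (8 * ((d : ℝ) + 1)) ^ (d + 1)) *
          (896 * d * (12 * (d : ℝ) + 8) ^ d) + (12 * (d : ℝ) + 8) ^ (d + 2)))) ^ d * (((ρ : ℝ) + 1) / ((N : ℝ) + 1)) ^ d * exc (fdiff μ u) x N +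
      4 / 3 * (4 * (4 * 2 ^ (d + 1) * ((4 : ℝ) ^ d * d ^ 2 * (1 + 56 * d) ^ d * ((2 : ℝ) ^ d * (1 + 56 * d) ^ d * (8 * ((d : ℝ) + 1)) ^ (d + 1)) *
          (896 * d * (12 * (d : ℝ) + 8) ^ d) + (12 * (d : ℝ) + 8) ^ (d + 2)))) ^ (2 * d) *
        ((4 * ((4 : ℝ) ^ d * d ^ 2 * (1 + 56 * d) ^ d * ((2 : ℝ) ^ d * (1 + 56 * d) ^ d * (8 * ((d : ℝ) + 1)) ^ (d + 1)) *
          (896 * d * (12 * (d : ℝ) + 8) ^ d) + (12 * (d : ℝ) + 8) ^ (d + 2)) + 2) * ((d : ℝ) * 5 ^ d * m ^ 2)) * ((ρ : ℝ) + 1) ^ d := by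
  set A₁ : ℝ := (4 : ℝ) ^ d * d ^ 2 * (1 + 56 * d) ^ d * ((2 : ℝ) ^ d * (1 + 56 * d) ^ d * (8 * ((d : ℝ) + 1)) ^ (d + 1)) *
          (896 * d * (12 * (d : ℝ) + 8) ^ d) + (12 * (d : ℝ) + 8) ^ (d + 2) with hA₁
  have hA₁0 : 0 ≤ A₁ := by positivity
  have hA₁1 : 1 ≤ A₁ := by
    rw [hA₁]
    have h1 : (1 : ℝ) ≤ (12 * (d : ℝ) + 8) ^ (d + 2) := one_le_pow₀ (by have : (0:ℝ) ≤ d := Nat.cast_nonneg d; linarith)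
    have h2 : (0 : ℝ) ≤ (4 : ℝ) ^ d * d ^ 2 * (1 + 56 * d) ^ d * ((2 : ℝ) ^ d * (1 + 56 * d) ^ d * (8 * ((d : ℝ) + 1)) ^ (d + 1)) *
          (896 * d * (12 * (d : ℝ) + 8) ^ d) := by positivity
    linarith
  set A : ℝ := 4 * 2 ^ (d + 1) * A₁ with hA
  have hA1 : 1 ≤ A := by
    rw [hA]; exact one_le_mul_of_one_le_of_one_le (one_le_mul_of_one_le_of_one_le (by norm_num) (one_le_pow₀ (by norm_num))) hA₁1
  set B : ℝ := (4 * A₁ + 2) * ((d : ℝ) * 5 ^ d * m ^ 2) with hB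
  have hB0 : 0 ≤ B := by positivity
  -- the integer-radius step at the centre `x` for all `0 ≤ ρ' ≤ r ≤ N`
  have hstep : ∀ ρ' r : ℤ, 0 ≤ ρ' → ρ' ≤ r → r ≤ N →
      exc (fdiff μ u) x ρ' ≤ 4 * A₁ * (((ρ' : ℝ) + 1) / ((r : ℝ) + 1)) ^ (d + 2) * exc (fdiff μ u) x r + B * ((r : ℝ) + 1) ^ d := by
    intro ρ' r h1 h2 h3
    have hsub : box x (r + 2) ⊆ box x (N + 2) := box_mono x (by linarith)
    have h := gradient_campanato_step_dvg hd u g x h1 h2 (fun y hy => hEq y (hsub hy)) (fun y hy => hg y (hsub hy)) μ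
    rw [← hA₁] at h
    rw [hB]
    linarith
  -- Campanato's iteration for `ψ(t) = exc (∂_μ u)(Q_{⌊t⌋-1}(x))` on `[1, N+1]`, `q = d`
  have hiter := campanato_iteration_sharp (ψ := fun t => exc (fdiff μ u) x (⌊t⌋ - 1)) (R₀ := (N : ℝ) + 1) (q := d) hA1 hB0
    (fun t _ _ => exc_nonneg _ _ _) (fun s t _ hst _ => exc_mono _ x (by linarith [Int.floor_le_floor hst]))
    (by
      intro P R hP hPR hR
      have := exc_campanato_hypothesis_d (fdiff μ u) x hA₁0 hB0 hstep P R hP hPR hR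
      rw [← hA] at this
      exact this)
  have hρR : (0 : ℝ) ≤ ρ := by exact_mod_cast hρ
  have hρNR : (ρ : ℝ) ≤ N := by exact_mod_cast hρN
  have hmain := hiter ((ρ : ℝ) + 1) ((N : ℝ) + 1) (by linarith) (by linarith) le_rfl
  have eP : ⌊(ρ : ℝ) + 1⌋ - 1 = ρ := by
    rw [show (ρ : ℝ) + 1 = ((ρ + 1 : ℤ) : ℝ) by push_cast; ring, Int.floor_intCast]; ring
  have eR : ⌊(N : ℝ) + 1⌋ - 1 = N := by
    rw [show (N : ℝ) + 1 = ((N + 1 : ℤ) : ℝ) by push_cast; ring, Int.floor_intCast]; ring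
  simp only [eP, eR] at hmain
  rw [hB] at hmain
  exact hmain

/-! ## §3 The logarithmic sup bound: a dyadic telescope of box means -/

/-- The mean over the one-point box is the value. [folklore] -/
theorem boxAvg_zero_radius (f : Zd d → ℝ) (x : Zd d) : boxAvg f x 0 = f x := by
  have hbox : box x 0 = {x} := by
    ext y
    simp only [mem_box, Finset.mem_singleton]
    constructor
    · intro h; funext i; have := h i; rw [abs_nonpos_iff, sub_eq_zero] at this; exact this
    · intro h i; rw [h, sub_self, abs_zero]
  rw [boxAvg_def, hbox, Finset.sum_singleton, Finset.card_singleton, Nat.cast_one, div_one]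

/-- **ONE DYADIC STEP**: for `0 ≤ ρ ≤ ρ' ≤ 2ρ+1` with the BMO-type bound `exc f (Q_{ρ'}) ≤ M²·(ρ'+1)^d` (`M ≥ 0`), the two means differ by at most `√(2^d)·M`
(`#Q_ρ·(avg_ρ − avg_{ρ'})² ≤ exc_{ρ'}` ✓`card_mul_sq_sub_le_exc`, `#Q_ρ = (2ρ+1)^d ≥ ((ρ'+1)∕2)^d`). [folklore] -/
theorem abs_boxAvg_sub_boxAvg_le (f : Zd d → ℝ) (x : Zd d) {ρ ρ' : ℤ} (hρ : 0 ≤ ρ) (hρρ' : ρ ≤ ρ') (hρ'2 : ρ' ≤ 2 * ρ + 1) {M : ℝ} (hM : 0 ≤ M)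
    (hexc : exc f x ρ' ≤ M ^ 2 * ((ρ' : ℝ) + 1) ^ d) :
    |boxAvg f x ρ - boxAvg f x ρ'| ≤ Real.sqrt ((2 : ℝ) ^ d) * M := by
  have hcard : ((box x ρ).card : ℝ) = ((2 * ρ + 1 : ℤ) : ℝ) ^ d := card_box x hρ
  have hkey := card_mul_sq_sub_le_exc f (box_mono x hρρ' : box x ρ ⊆ box x ρ')
  -- `(2ρ+1)^d (avg_ρ − avg_ρ')² ≤ M² (ρ'+1)^d ≤ M² 2^d (2ρ+1)^d`
  have hρR : (0 : ℝ) ≤ ρ := by exact_mod_cast hρ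
  have hρρ'R : (ρ : ℝ) ≤ ρ' := by exact_mod_cast hρρ'
  have hρ'2R : (ρ' : ℝ) ≤ 2 * ρ + 1 := by exact_mod_cast hρ'2
  have hc0 : (0 : ℝ) < ((2 * ρ + 1 : ℤ) : ℝ) ^ d := by push_cast; positivity
  have h2 : ((ρ' : ℝ) + 1) ^ d ≤ (2 : ℝ) ^ d * ((2 * ρ + 1 : ℤ) : ℝ) ^ d := by
    rw [← mul_pow]
    apply pow_le_pow_left₀ (by linarith)
    push_cast; linarith
  rw [hcard] at hkey
  have h3 : ((2 * ρ + 1 : ℤ) : ℝ) ^ d * (boxAvg f x ρ - boxAvg f x ρ') ^ 2 ≤ M ^ 2 * ((2 : ℝ) ^ d * ((2 * ρ + 1 : ℤ) : ℝ) ^ d) :=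
    hkey.trans (hexc.trans (mul_le_mul_of_nonneg_left h2 (sq_nonneg M)))
  have hsq : (boxAvg f x ρ - boxAvg f x ρ') ^ 2 ≤ (Real.sqrt ((2 : ℝ) ^ d) * M) ^ 2 := by
    rw [mul_pow, Real.sq_sqrt (by positivity)]
    have h4 := div_le_div_of_nonneg_right h3 hc0.le
    rw [mul_div_cancel_left₀ _ hc0.ne'] at h4
    calc (boxAvg f x ρ - boxAvg f x ρ') ^ 2 ≤ M ^ 2 * ((2 : ℝ) ^ d * ((2 * ρ + 1 : ℤ) : ℝ) ^ d) / ((2 * ρ + 1 : ℤ) : ℝ) ^ d := h4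
      _ = (2 : ℝ) ^ d * M ^ 2 := by field_simp
  have h5 : |boxAvg f x ρ - boxAvg f x ρ'| ^ 2 ≤ (Real.sqrt ((2 : ℝ) ^ d) * M) ^ 2 := by rw [sq_abs]; exact hsq
  exact (pow_le_pow_iff_left₀ (abs_nonneg _) (by positivity) two_ne_zero).mp h5

/-- **THE DYADIC TELESCOPE**: if `exc f (Q_ρ(x)) ≤ M²(ρ+1)^d` for all `0 ≤ ρ ≤ N`, then for every `n` with `2^n − 1 ≤ N`:
`|f x − avg_{Q_{2^n−1}(x)} f| ≤ n·√(2^d)·M` (`Q_0 = {x}`, radii `2^k − 1`). [folklore] -/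
theorem abs_sub_boxAvg_dyadic_le (f : Zd d → ℝ) (x : Zd d) {N : ℤ} {M : ℝ} (hM : 0 ≤ M) (hexc : ∀ ρ : ℤ, 0 ≤ ρ → ρ ≤ N → exc f x ρ ≤ M ^ 2 * ((ρ : ℝ) + 1) ^ d) :
    ∀ n : ℕ, (2 : ℤ) ^ n - 1 ≤ N → |f x - boxAvg f x ((2 : ℤ) ^ n - 1)| ≤ n * (Real.sqrt ((2 : ℝ) ^ d) * M) := by
  intro n
  induction n with
  | zero => intro _; simp [boxAvg_zero_radius]
  | succ n ih =>
    intro hn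
    have hpow : (1 : ℤ) ≤ 2 ^ n := one_le_pow₀ (by norm_num)
    have hn' : (2 : ℤ) ^ n - 1 ≤ N := by
      have : (2 : ℤ) ^ n ≤ 2 ^ (n + 1) := pow_le_pow_right₀ (by norm_num) (by omega)
      linarith
    have hstep := abs_boxAvg_sub_boxAvg_le f x (ρ := (2 : ℤ) ^ n - 1) (ρ' := (2 : ℤ) ^ (n + 1) - 1) (by linarith)
      (by have : (2 : ℤ) ^ n ≤ 2 ^ (n + 1) := pow_le_pow_right₀ (by norm_num) (by omega); linarith) (by rw [pow_succ]; linarith) hM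
      (hexc _ (by have : (1 : ℤ) ≤ 2 ^ (n + 1) := one_le_pow₀ (by norm_num); linarith) hn)
    calc |f x - boxAvg f x ((2 : ℤ) ^ (n + 1) - 1)|
        = |(f x - boxAvg f x ((2 : ℤ) ^ n - 1)) + (boxAvg f x ((2 : ℤ) ^ n - 1) - boxAvg f x ((2 : ℤ) ^ (n + 1) - 1))| := by ring_nf
      _ ≤ |f x - boxAvg f x ((2 : ℤ) ^ n - 1)| + |boxAvg f x ((2 : ℤ) ^ n - 1) - boxAvg f x ((2 : ℤ) ^ (n + 1) - 1)| := abs_add_le _ _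
      _ ≤ n * (Real.sqrt ((2 : ℝ) ^ d) * M) + Real.sqrt ((2 : ℝ) ^ d) * M := add_le_add (ih hn') hstep
      _ = ((n + 1 : ℕ) : ℝ) * (Real.sqrt ((2 : ℝ) ^ d) * M) := by push_cast; ring

/-- ★★★ **THE LOGARITHMIC SUP BOUND (BMO ⇒ `ℓ^∞` up to `log`)**: if `exc f (Q_ρ(x)) ≤ M²(ρ+1)^d` for all `0 ≤ ρ ≤ N` (`N ≥ 0`, `M ≥ 0`), then
`|f x − avg_{Q_N(x)} f| ≤ (Nat.log 2 (N+1) + 1)·√(2^d)·M` — `log₂(N+1) + 1` dyadic steps (radii `2^k − 1` up to `2^n − 1 ≤ N < 2^{n+1} − 1`, then one step to `N`).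
Combined with §2 this is the `ℓ^∞` bound of the lattice Riesz transform `∇Δ⁻¹∂*` up to the logarithm of the number of scales. [folklore]
[cite: Giaquinta1984, Ch. III §1 Thm 1.2 p.70] -/
theorem abs_sub_boxAvg_le_log (f : Zd d → ℝ) (x : Zd d) {N : ℤ} (hN : 0 ≤ N) {M : ℝ} (hM : 0 ≤ M)
    (hexc : ∀ ρ : ℤ, 0 ≤ ρ → ρ ≤ N → exc f x ρ ≤ M ^ 2 * ((ρ : ℝ) + 1) ^ d) :
    |f x - boxAvg f x N| ≤ ((Nat.log 2 (N + 1).toNat : ℝ) + 1) * (Real.sqrt ((2 : ℝ) ^ d) * M) := by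
  set n : ℕ := Nat.log 2 (N + 1).toNat with hn
  have hN1 : ((N + 1).toNat : ℤ) = N + 1 := Int.toNat_of_nonneg (by linarith)
  have hN1pos : (N + 1).toNat ≠ 0 := by
    intro h; have := hN1; rw [h] at this; simp at this; linarith
  -- `2^n ≤ N+1 < 2^(n+1)`
  have hlow : ((2 : ℕ) ^ n : ℕ) ≤ (N + 1).toNat := Nat.pow_log_le_self 2 hN1pos
  have hup : (N + 1).toNat < 2 ^ (n + 1) := Nat.lt_pow_succ_log_self (by norm_num) _
  have hlowZ : (2 : ℤ) ^ n - 1 ≤ N := by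
    have : (((2 : ℕ) ^ n : ℕ) : ℤ) ≤ ((N + 1).toNat : ℤ) := by exact_mod_cast hlow
    rw [hN1] at this; push_cast at this; linarith
  have hupZ : N ≤ 2 * ((2 : ℤ) ^ n - 1) + 1 := by
    have : ((N + 1).toNat : ℤ) < (((2 : ℕ) ^ (n + 1) : ℕ) : ℤ) := by exact_mod_cast hup
    rw [hN1] at this; push_cast at this; rw [pow_succ] at this; linarith
  have h1 := abs_sub_boxAvg_dyadic_le f x hM hexc n hlowZ
  have h2 := abs_boxAvg_sub_boxAvg_le f x (ρ := (2 : ℤ) ^ n - 1) (ρ' := N) (by have : (1:ℤ) ≤ 2 ^ n := one_le_pow₀ (by norm_num); linarith) hlowZ hupZ hM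
    (hexc N hN le_rfl)
  calc |f x - boxAvg f x N| = |(f x - boxAvg f x ((2 : ℤ) ^ n - 1)) + (boxAvg f x ((2 : ℤ) ^ n - 1) - boxAvg f x N)| := by ring_nf
    _ ≤ |f x - boxAvg f x ((2 : ℤ) ^ n - 1)| + |boxAvg f x ((2 : ℤ) ^ n - 1) - boxAvg f x N| := abs_add_le _ _
    _ ≤ n * (Real.sqrt ((2 : ℝ) ^ d) * M) + Real.sqrt ((2 : ℝ) ^ d) * M := add_le_add h1 h2
    _ = ((n : ℝ) + 1) * (Real.sqrt ((2 : ℝ) ^ d) * M) := by ring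


/-- ★★★ **THE LOGARITHMIC GRADIENT BOUND FOR `−Δu = ∂*g`, `|g| ≤ m` (RIESZ-LOG)**: `d ≥ 1`, `N ≥ 0`; if `−Δu = ∂*g` on `Q_{N+2}(x)` with `|g| ≤ m` there, and
`M ≥ 0` dominates the BMO constant of §2 — `(4A)^d·exc (∂_μu)(Q_N(x))∕(N+1)^d + (4∕3)(4A)^{2d}(4A₁+2)·d·5^d·m² ≤ M²` — then
`|∂_μu(x) − avg_{Q_N(x)} ∂_μu| ≤ (log₂(N+1) + 1)·√(2^d)·M`: the lattice Riesz transform of bounded data is bounded up to the logarithm of the number of scales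
(the top-scale mean `avg_{Q_N}∂_μu` and `exc(Q_N) ≤ Σ_{Q_N}|∇u|²` are the consumer's global `ℓ²` data). [folklore]
[cite: Giaquinta1984, Ch. III §3 Thm 3.1 p.84, §1 Thm 1.2 p.70; Balaban1984PropagatorsII, (1.9) p.226] -/
theorem abs_fdiff_sub_boxAvg_le_log_of_dvg (hd : 1 ≤ d) (u : Zd d → ℝ) (g : Zd d → Fin d → ℝ) (x : Zd d) {m : ℝ} {N : ℤ} (hN : 0 ≤ N)
    (hEq : ∀ y ∈ box x (N + 2), lop 0 u y = dvg g y) (hg : ∀ y ∈ box x (N + 2), ∀ ν, |g y ν| ≤ m) (μ : Fin d) {M : ℝ} (hM : 0 ≤ M)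
    (hMbig : (4 * (4 * 2 ^ (d + 1) * ((4 : ℝ) ^ d * d ^ 2 * (1 + 56 * d) ^ d * ((2 : ℝ) ^ d * (1 + 56 * d) ^ d * (8 * ((d : ℝ) + 1)) ^ (d + 1)) *
          (896 * d * (12 * (d : ℝ) + 8) ^ d) + (12 * (d : ℝ) + 8) ^ (d + 2)))) ^ d * (exc (fdiff μ u) x N / ((N : ℝ) + 1) ^ d) +
      4 / 3 * (4 * (4 * 2 ^ (d + 1) * ((4 : ℝ) ^ d * d ^ 2 * (1 + 56 * d) ^ d * ((2 : ℝ) ^ d * (1 + 56 * d) ^ d * (8 * ((d : ℝ) + 1)) ^ (d + 1)) *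
          (896 * d * (12 * (d : ℝ) + 8) ^ d) + (12 * (d : ℝ) + 8) ^ (d + 2)))) ^ (2 * d) *
        ((4 * ((4 : ℝ) ^ d * d ^ 2 * (1 + 56 * d) ^ d * ((2 : ℝ) ^ d * (1 + 56 * d) ^ d * (8 * ((d : ℝ) + 1)) ^ (d + 1)) *
          (896 * d * (12 * (d : ℝ) + 8) ^ d) + (12 * (d : ℝ) + 8) ^ (d + 2)) + 2) * ((d : ℝ) * 5 ^ d * m ^ 2)) ≤ M ^ 2) :
    |fdiff μ u x - boxAvg (fdiff μ u) x N| ≤ ((Nat.log 2 (N + 1).toNat : ℝ) + 1) * (Real.sqrt ((2 : ℝ) ^ d) * M) := by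
  refine abs_sub_boxAvg_le_log (fdiff μ u) x hN hM fun ρ hρ hρN => ?_
  have h := exc_fdiff_le_of_dvg hd u g x hEq hg μ hρ hρN
  have hρ0 : (0 : ℝ) ≤ ρ := by exact_mod_cast hρ
  have hρ1 : (0 : ℝ) ≤ ((ρ : ℝ) + 1) ^ d := by positivity
  have e : (((ρ : ℝ) + 1) / ((N : ℝ) + 1)) ^ d = ((ρ : ℝ) + 1) ^ d / ((N : ℝ) + 1) ^ d := div_pow _ _ _
  rw [e] at h
  have key := mul_le_mul_of_nonneg_right hMbig hρ1
  refine h.trans (le_of_eq_of_le ?_ key)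
  ring

end Summit.QuantumFields.YangMills.Theorems.PoincareLipschitzFlatRieszLog

end
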